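import Summits.QuantumFields.BalabanUV.Beta.CombRemainderTadpoleSlot
import Summits.QuantumFields.BalabanUV.Beta.SymCorrectorLiteralLoc
import Summits.QuantumFields.BalabanUV.Beta.D1BFx.RoadLitPinAn1W
import Summits.QuantumFields.BalabanUV.Beta.D1BFx.RoadJ1Absorption

/-!
# `BalabanUV.Beta.D1BFx.RoadLitWSlotTadpole` — road «BF-x», row D1: **THE W-SLOT CARRY OF PART 22″ AT THE (III″) LITERAL, WORD BY WORD — THE CHAIN WORD IS A
# TYPED ZERO (W2″b), THE PAIR WORD AND THE TWO MIXED WORDS REMAIN (W2″a)** (SPEC (J2)″ v1.1 §1 «W2″b := ONE PARITY LETTER … discharged inside PART 22″ from the tree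
# lemma `CombRemainderTadpoleSlot.tadpole_dM_SpureRecOf_eq_zero` … the zero transports to the `G₀^{bm}`-legged form word by word (≤ 30 l. inside PART 22″ if a named
# lemma is wanted — the road's)»; an2 R-D1-g58-1 §3; the road's W-g30-1)

THE MATHEMATICS (d = 3, `n` odd, any in-block root `r`).  PART 22″ (`RoadEndBFxRoadScalesWFlatS`, `RoadEndBFxLitWS`) books on the (J2)-W dictionary's left side the
carry `½·tadpole (G₀ n) (W n μ 0 ν z) − ½·tadpole (G₀ n) (vertex2OfK (G₀ n) n (S₂ n) μ 0 ν z)`, `G₀ n := coDressKBmAt (toSite (r n)) n (KInvStep n 0)`, with `W n` PINNED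
to the DRESSED literal's second-order table `(JsB12CombShSym … 0).W`.  This file computes the first term in the literal's OWN gauge:
* §1 (generic `d`) the TADPOLE HALVES of an2's dressing lemmas as standalone identities: `tadpole K (dressKSymAt ρ N W) = tadpole (coDressKSymAt ρ N K) W` and
  `tadpole K (dressKAt ρ N W) = tadpole (coDressKAt ρ N K) W` for spread `K`, localised `W` (tame trace cyclicity — the `htad` steps of
  `SymmetrisedDressingHessian.hessKer_dressSymAt` ∕ `AxialDressingRootedHessian.hessKer_dressAt`, re-derived verbatim);
* §2 (any table record) **`tadpole_G₀bm_dressedW`**: `tadpole (G₀^{bm} r) ((JsB12CombShSym hn N tabs cΛ cB 0).W μ y ν y′) = tadpole (GcombSh n 0) ((JsB12CombSh0 hn N tabs cΛ cB 0).W μ y ν y′)`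
  — the two dressings move onto the kernel, `Π̂^{sym}_bm ∘ Π_bm = Π̂^{sym}_bm` (the owner's `SymBmAbsorbsBm.coDressKSymAt_coDressKBmAt`), and `GcombSh n 0` IS
  `coDressKAt ρ_c (coDressKSymAt ρ_c (KInvStep n 0))` (`rfl`): THE DRESSED TABLE's TADPOLE AT THE ROAD's KERNEL IS THE RAW TABLE's TADPOLE AT THE LITERAL's OWN LEG;
* §3 (an1's weighted record `symTablesAn1S2w 3 n cΛ w`, table pin = first-order pin) **`tadpole_GcombSh_rawW_words`**: the raw table is the swap-symmetrised four-word carrier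
  `W2SymOfK G′ n S♭ M T₂ M₂` (`SymCorrectorLiteralW.JsB12CombSh0_W_zero_eq`, `rfl`); its tadpole at `G′ := GcombSh n 0` splits word by word (`TameKernelCalculus.tadpole_add`,
  every word localised by leaf-03's TT8∕TT9 and the owner's `loc_vertex2OfK_of_spr`) and THE CHAIN WORD `dM (K2OfK G′ n S♭ M ν y′) n S♭ M μ y` HAS TADPOLE ZERO
  (`CombRemainderTadpoleSlot.tadpole_dM_SpureRecOf_eq_zero` at `K′ := K2OfK …`, both bond orders):
  `tadpole G′ (W⁰ μ y ν y′) = ½·(tadpole G′ (vertex2OfK G′ n T₂ μ y ν y′) + tadpole G′ (vertex2OfK G′ n T₂ ν y′ μ y)) + (tadpole G′ (mixOfK G′ n M₂ μ y ν y′) + tadpole G′ (mixOfK G′ n M₂ ν y′ μ y))`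
  with `T₂ = n⁸ • wilsonW₂ 3 ((8N²)⁻¹ • wsym22 N) + cB • symVh₂SAn1 3 n` (the record's TableR second partials) and `M₂ = M2Of 3 n (w • symMixFFAt ρ_c n) 0` (W2″a's table);
* §4 **`carry_lit_words`**: §2 + §3 at the scales `n = Lc^m` for PART 22″-lit's pinned `W` (`RoadLitPinAn1W.W_at_pow`): the carry's first term IS the pair-word tadpole
  plus W2″a's two mixed-word tadpoles at the literal's own leg — NO chain word.  The second term `½·tadpole (G₀ n) (vertex2OfK (G₀ n) n (S₂ n) μ 0 ν z)` stays the
  caller's (its `S₂`); the difference of the two pair words is the pair slot's chart word (→ `RJ2`, SPEC §3).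

HONEST DEPENDENCY (cell records, verbatim): «continuum YM on T⁴ ⇐ BetaPertH ∧ nine spine estimates (0/9 proved); BetaPertH ⇐ (D1) ∧ (D4) ∧
CAP+tail; G-an2-4 gates asym, D1 and NE2/3/4.»  HONEST FRAMING (cell contract, verbatim): «discharging `BetaPertH` makes Bałaban's UV stability
UNCONDITIONAL — a real constructive-QFT result; it is NOT the continuum limit and NOT the Clay problem.»  THIS MODULE DISCHARGES NOTHING of (K), of the
(J2)-W dictionary, of D1 or of the wall: [folklore] exact identities between OUR kernels BY NAME (trace cyclicity, an absorption identity, a parity zero);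
it names the words a supplier of `hJ2` meets — it prices NO row, asserts NO value and NO Ward law.  No definition, no `def … : Prop`, nothing cited, 0 sorry.
0∕4 row-D1 binders; (K) NOT closed; NOT D1, NEVER «G-an2-4 closed», NOT `BetaPertH`, NOT continuum, NOT Clay.

ABSOLUTE RULE (cell charter, verbatim): «No internally-minted statement may enter as a cited fact. Every hypothesis is either kernel-proved in this
package or a verbatim quotation of a PUBLISHED theorem with page reference. The manuscript(s) under audit are NOT citable for their own disputed
steps — they are the thing under adjudication; programme-internal (2001/route/tribunal) claims are never citable.»

Unit `b2b-balaban-beta-d1-p2` (road owner, gen 31), 2026-08-25; no existing file touched.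
-/

noncomputable section

namespace Summit.QuantumFields.BalabanUV.Beta.D1BFx.RoadLitWSlotTadpole

open Literature.MathematicalPhysics.QuantumFieldTheory
open Literature.MathematicalPhysics.QuantumFieldTheory.Balaban1983to89
open Literature.MathematicalPhysics.QuantumFieldTheory.Balaban1983to89.Beta
open ExpKernelCalculus (MKer Decays BiLoc comp tr tadpole)
open OneStepResolventKernel (Fib JetData LocStencil)
open OneStepKernelFamily (KInvStep vertexOfK TshotOf)
open SecondOrderResponse (dM K2OfK mixOfK vertex2OfK W2OfK W2SymOfK)
open BalabanStepW2 (M2Of)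
open StepJetData (wilsonA)
open WilsonBiStencil (wilsonW₂)
open WilsonVertex2Sym (wsym22)
open AffineAveraging (Site box toSite)
open AveragingContoursRooted (ctr ctrOff ctrOff_mem_box)
open KernelReflection (tadpole_smul)
open Summit.QuantumFields.BalabanUV.Beta.TameKernelCalculus
open Summit.QuantumFields.BalabanUV.Beta.ChartConjugationRelative (spr_comp)
open Summit.QuantumFields.BalabanUV.Beta.AxialDressingRooted (dressAt coDressKBmAt one_le_of_neZero piK dressKAt coDressKAt spr_piK spr_trK_piK
  dressKAt_eq_comp coDressKAt_eq dressAt_W decays_coDressKBmAt_KInvStep)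
open Summit.QuantumFields.BalabanUV.Beta.SymmetrisedDressingKernel (piKSymBm dressKSymAt coDressKSymAt spr_piKSymBm spr_trK_piKSymBm coDressKSymAt_eq spr_coDressKSymAt)
open Summit.QuantumFields.BalabanUV.Beta.SymmetrisedDressingDress (dressSymAt dressSymAt_W)
open Summit.QuantumFields.BalabanUV.Beta.SymmetrisedStepJets (SymTables)
open Summit.QuantumFields.BalabanUV.Beta.SymAveragingHessianCounts (symVhSAt symHessFFAt)
open Summit.QuantumFields.BalabanUV.Beta.SymAveragingMixedJetTables (symMixFFAt)
open Summit.QuantumFields.BalabanUV.Beta.SymSecondOrderTablesAn1 (symVh₂SAn1)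
open Summit.QuantumFields.BalabanUV.Beta.SymTablesAn1S2Weighted (symTablesAn1S2w)
open Summit.QuantumFields.BalabanUV.Beta.SpineRooted (M1Of SpureRecOf)
open Summit.QuantumFields.BalabanUV.Beta.CombChartStepJets (GcombSh JsB12CombSh0 decays_GcombSh locStencil_SpureCombOf)
open Summit.QuantumFields.BalabanUV.Beta.CombChartContactFactor (spr_GcombSh)
open Summit.QuantumFields.BalabanUV.Beta.CombChartJointEnd (JsB12CombShSym JsB12CombShSym_eq)
open Summit.QuantumFields.BalabanUV.Beta.CombOneShotJetsTabs (JcOfTabs JcOfTabs_apply)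
open Summit.QuantumFields.BalabanUV.Beta.CombRemainderTadpoleSlot (tadpole_dM_SpureRecOf_eq_zero)
open Summit.QuantumFields.BalabanUV.Beta.SymCorrectorLiteralW (loc_dM_of_spr JsB12CombSh0_W_zero_eq)
open Summit.QuantumFields.BalabanUV.Beta.SymCorrectorLiteralLoc (loc_dM_of_loc loc_mixOfK_of_spr locStencil₂_literalS₂ locStencilFM_literalM₂)
open Summit.QuantumFields.BalabanUV.Beta.D1BFx.SymBmAbsorbsBm (coDressKSymAt_coDressKBmAt)
open Summit.QuantumFields.BalabanUV.Beta.D1BFx.ChartDefectWords (loc_jetData_W loc_vertex2OfK_of_spr)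

variable {d : ℕ}

/-! ## §1 The tadpole halves of the two dressing lemmas (generic `d`) -/

section Dressing

variable {N : ℕ} [NeZero N] {r : Fin (d + 1) → ℕ}

/-- [folklore] **TADPOLE HALF OF THE SYMMETRISED BLOCK-MEAN DRESSING LEMMA**: `tr(K·Π̂ W Π̂ᵀ) = tr((Π̂ᵀ K Π̂)·W)` — for a spread `K` and a localised `W`,
`tadpole K (dressKSymAt ρ N W) = tadpole (coDressKSymAt ρ N K) W` (an2's `hessKer_dressSymAt`, the `htad` step, standalone). -/
theorem tadpole_dressKSymAt (hr : r ∈ box (d + 1) N) {K W : MKer (d + 1) (Fib d)} (sK : Spr K) (lW : Loc W) :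
    tadpole K (dressKSymAt (toSite r) N W) = tadpole (coDressKSymAt (toSite r) N K) W := by
  have hN : 1 ≤ N := one_le_of_neZero N
  have sP : Spr (piKSymBm (toSite r) N) := spr_piKSymBm hN hr
  have sPt : Spr (trK (piKSymBm (toSite r) N)) := spr_trK_piKSymBm hN hr
  have sPtK : Spr (comp (trK (piKSymBm (toSite r) N)) K) := spr_comp sPt sK
  have lPW : Loc (comp (piKSymBm (toSite r) N) W) := sP.comp_loc lW
  have lPWPt : Loc (comp (comp (piKSymBm (toSite r) N) W) (trK (piKSymBm (toSite r) N))) := lPW.comp_spr sPt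
  unfold ExpKernelCalculus.tadpole
  rw [show dressKSymAt (toSite r) N W = comp (comp (piKSymBm (toSite r) N) W) (trK (piKSymBm (toSite r) N)) from rfl]
  calc tr (comp K (comp (comp (piKSymBm (toSite r) N) W) (trK (piKSymBm (toSite r) N))))
      = tr (comp (comp (comp (piKSymBm (toSite r) N) W) (trK (piKSymBm (toSite r) N))) K) := (tr_comp_comm_loc lPWPt sK.tame).symm
    _ = tr (comp (comp (piKSymBm (toSite r) N) W) (comp (trK (piKSymBm (toSite r) N)) K)) := by rw [← comp_assoc_tame lPW.tame sPt.tame sK.tame]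
    _ = tr (comp (comp (trK (piKSymBm (toSite r) N)) K) (comp (piKSymBm (toSite r) N) W)) := tr_comp_comm_loc lPW sPtK.tame
    _ = tr (comp (comp (comp (trK (piKSymBm (toSite r) N)) K) (piKSymBm (toSite r) N)) W) := by rw [comp_assoc_tame sPtK.tame sP.tame lW.tame]
    _ = tr (comp (coDressKSymAt (toSite r) N K) W) := by rw [coDressKSymAt_eq]

/-- [folklore] **TADPOLE HALF OF THE ROOTED AXIAL DRESSING LEMMA**: `tadpole K (dressKAt ρ N W) = tadpole (coDressKAt ρ N K) W` (an2's `hessKer_dressAt`, the `htad` step). -/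
theorem tadpole_dressKAt (hr : r ∈ box (d + 1) N) {K W : MKer (d + 1) (Fib d)} (sK : Spr K) (lW : Loc W) :
    tadpole K (dressKAt (toSite r) N W) = tadpole (coDressKAt (toSite r) N K) W := by
  have hN : 1 ≤ N := one_le_of_neZero N
  have sP : Spr (piK (toSite r) N) := spr_piK hN hr
  have sPt : Spr (trK (piK (toSite r) N)) := spr_trK_piK hN hr
  have sPtK : Spr (comp (trK (piK (toSite r) N)) K) := spr_comp sPt sK
  have lPW : Loc (comp (piK (toSite r) N) W) := sP.comp_loc lW
  have lPWPt : Loc (comp (comp (piK (toSite r) N) W) (trK (piK (toSite r) N))) := lPW.comp_spr sPt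
  unfold ExpKernelCalculus.tadpole
  rw [dressKAt_eq_comp]
  calc tr (comp K (comp (comp (piK (toSite r) N) W) (trK (piK (toSite r) N))))
      = tr (comp (comp (comp (piK (toSite r) N) W) (trK (piK (toSite r) N))) K) := (tr_comp_comm_loc lPWPt sK.tame).symm
    _ = tr (comp (comp (piK (toSite r) N) W) (comp (trK (piK (toSite r) N)) K)) := by rw [← comp_assoc_tame lPW.tame sPt.tame sK.tame]
    _ = tr (comp (comp (trK (piK (toSite r) N)) K) (comp (piK (toSite r) N) W)) := tr_comp_comm_loc lPW sPtK.tame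
    _ = tr (comp (comp (comp (trK (piK (toSite r) N)) K) (piK (toSite r) N)) W) := by rw [comp_assoc_tame sPtK.tame sP.tame lW.tame]
    _ = tr (comp (coDressKAt (toSite r) N K) W) := by rw [coDressKAt_eq]

end Dressing

/-! ## §2 The dressed table's tadpole at the road's kernel is the raw table's tadpole at the literal's own leg (any record, any in-block root) -/

section Literal

variable (n : ℕ) [NeZero n] (hn : Odd n) (N : ℕ) (tabs : SymTables 3 n) (cΛ cB : ℝ)

/-- [folklore] **THE W-SLOT CARRY's FIRST TERM IN THE LITERAL's OWN GAUGE**: for every in-block root `r`,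
`tadpole (coDressKBmAt (toSite r) n (KInvStep n 0)) ((JsB12CombShSym hn N tabs cΛ cB 0).W μ y ν y′) = tadpole (GcombSh n 0) ((JsB12CombSh0 hn N tabs cΛ cB 0).W μ y ν y′)`
— `(JsB12CombShSym …).W = dressKSymAt ρ_c (dressKAt ρ_c W⁰)` (`rfl`), §1 twice, the absorption `coDressKSymAt ρ_c (G₀^{bm} r) = coDressKSymAt ρ_c (KInvStep n 0)`, and
`GcombSh n 0 = coDressKAt ρ_c (coDressKSymAt ρ_c (KInvStep n 0))` (`rfl`). -/
theorem tadpole_G₀bm_dressedW {r : Fin 4 → ℕ} (hr : r ∈ box (3 + 1) n) (μ : Fin 4) (y : Fin 4 → ℤ) (ν : Fin 4) (y' : Fin 4 → ℤ) :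
    tadpole (coDressKBmAt (toSite r) n (KInvStep (d := 3) n 0)) ((JsB12CombShSym hn N tabs cΛ cB 0).W μ y ν y')
      = tadpole (GcombSh n 0) ((JsB12CombSh0 hn N tabs cΛ cB 0).W μ y ν y') := by
  have hN : 1 ≤ n := one_le_of_neZero n
  have hρ : ctrOff 4 n ∈ box (3 + 1) n := ctrOff_mem_box (d := 4) hN
  have sKI : Spr (KInvStep (d := 3) n 0) := by
    obtain ⟨δ, C, hδ, -, h⟩ := OneStepKernelFamily.decays_KInvStep (d := 3) (Lc := n) 0
    exact ⟨C, δ, hδ, h⟩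
  have sG : Spr (coDressKBmAt (toSite r) n (KInvStep (d := 3) n 0)) := by
    obtain ⟨δ, C, hδ, -, h⟩ := decays_coDressKBmAt_KInvStep (d := 3) hr 0
    exact ⟨C, δ, hδ, h⟩
  have sS : Spr (coDressKSymAt (toSite (ctrOff 4 n)) n (KInvStep (d := 3) n 0)) := spr_coDressKSymAt hN hρ sKI
  -- the raw table and its axially dressed image are localised (the data's own certificates)
  have lW0 : Loc ((JsB12CombSh0 hn N tabs cΛ cB 0).W μ y ν y') := loc_jetData_W _ μ y ν y'
  have lW1 : Loc (dressKAt (toSite (ctrOff 4 n)) n ((JsB12CombSh0 hn N tabs cΛ cB 0).W μ y ν y')) := by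
    have h := loc_jetData_W (dressAt hρ (JsB12CombSh0 hn N tabs cΛ cB 0)) μ y ν y'
    rwa [dressAt_W] at h
  rw [JsB12CombShSym_eq, dressSymAt_W, dressAt_W, tadpole_dressKSymAt hρ sG lW1,
    coDressKSymAt_coDressKBmAt hN hr hρ sKI, tadpole_dressKAt hρ sS lW0]
  rfl

end Literal

/-! ## §3 At an1's weighted record: the raw table's tadpole at `G′` splits into the pair word and the two mixed words — the chain word is a typed zero -/

section Words

variable (n : ℕ) [NeZero n] (hn : Odd n) (N : ℕ) (cΛ w cB : ℝ)

omit hn in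
/-- [folklore] **THE CHAIN WORD HAS TADPOLE ZERO AT THE RECORD, EITHER BOND ORDER**: `tadpole G′ (dM (K2OfK G′ n S♭ M ν y′) n S♭ M μ y) = 0` for `G′ := GcombSh n 0`,
`S♭ := SpureRecOf … cΛ 0` (an1's `V`, `H`), `M := M1Of 3 n (symHessFFAt ρ_c n) cΛ 0` — `CombRemainderTadpoleSlot.tadpole_dM_SpureRecOf_eq_zero` at the weight kernel
`K′ := K2OfK G′ n S♭ M ν y′` (localisation: leaf-03's `loc_dM_of_spr` ∕ `loc_dM_of_loc`, the record's own letters). -/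
theorem tadpole_chainWord_eq_zero (μ : Fin 4) (y : Fin 4 → ℤ) (ν : Fin 4) (y' : Fin 4 → ℤ) :
    tadpole (GcombSh n 0)
      (dM (K2OfK (GcombSh n 0) n (SpureRecOf 3 n (symVhSAt (ctr 4 n) 3 n) (symHessFFAt (ctr 4 n) n) (GcombSh n) ((n : ℝ) ^ 4) (-((n : ℝ) ^ 8 / 2)) cΛ 0)
          (M1Of 3 n (symHessFFAt (ctr 4 n) n) cΛ 0) ν y') n
        (SpureRecOf 3 n (symVhSAt (ctr 4 n) 3 n) (symHessFFAt (ctr 4 n) n) (GcombSh n) ((n : ℝ) ^ 4) (-((n : ℝ) ^ 8 / 2)) cΛ 0)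
        (M1Of 3 n (symHessFFAt (ctr 4 n) n) cΛ 0) μ y) = 0 := by
  have sG : Spr (GcombSh (d := 3) n 0) := spr_GcombSh (d := 3) (Lc := n) 0
  -- the letters of `S♭`, `M` read off an1's weighted record at ANY weight (its first-order slots do not see the weight): weight `0`
  obtain ⟨Cs, δs, hδs, hS⟩ := locStencil_SpureCombOf (d := 3) (symTablesAn1S2w 3 n cΛ 0) ((n : ℝ) ^ 4) (-((n : ℝ) ^ 8 / 2)) cΛ 0
  obtain ⟨CM, δM, hδM, hM⟩ := (symTablesAn1S2w 3 n cΛ 0).hM 0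
  have lK2 : Loc (K2OfK (GcombSh n 0) n
      (SpureRecOf 3 n (symVhSAt (ctr 4 n) 3 n) (symHessFFAt (ctr 4 n) n) (GcombSh n) ((n : ℝ) ^ 4) (-((n : ℝ) ^ 8 / 2)) cΛ 0)
      (M1Of 3 n (symHessFFAt (ctr 4 n) n) cΛ 0) ν y') := by
    have h := ((sG.comp_loc (loc_dM_of_spr sG hS hδs hM hδM ν y')).comp_spr sG).neg
    exact h
  exact tadpole_dM_SpureRecOf_eq_zero (Lc := n) cΛ 0 _ μ y (loc_dM_of_loc lK2 hS hδs hM hδM μ y)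

/-- [folklore] **THE RAW TABLE's TADPOLE AT THE LITERAL's LEG, WORD BY WORD, AT THE WEIGHTED RECORD** (table pin = first-order pin `cΛ`): with `G′ := GcombSh n 0`,
`T₂ := n⁸ • wilsonW₂ 3 ((8N²)⁻¹ • wsym22 N) + cB • symVh₂SAn1 3 n`, `M₂ := M2Of 3 n (w • symMixFFAt ρ_c n) 0`:
`tadpole G′ ((JsB12CombSh0 hn N (symTablesAn1S2w 3 n cΛ w) cΛ cB 0).W μ y ν y′)
 = ½·(tadpole G′ (vertex2OfK G′ n T₂ μ y ν y′) + tadpole G′ (vertex2OfK G′ n T₂ ν y′ μ y)) + (tadpole G′ (mixOfK G′ n M₂ μ y ν y′) + tadpole G′ (mixOfK G′ n M₂ ν y′ μ y))`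
— the swap-symmetrised four-word carrier opened (`JsB12CombSh0_W_zero_eq`, `rfl`), `tadpole_smul ∕ tadpole_add` on localised words, the two chain words ZERO
(`tadpole_chainWord_eq_zero`). -/
theorem tadpole_GcombSh_rawW_words (μ : Fin 4) (y : Fin 4 → ℤ) (ν : Fin 4) (y' : Fin 4 → ℤ) :
    tadpole (GcombSh n 0) ((JsB12CombSh0 hn N (symTablesAn1S2w 3 n cΛ w) cΛ cB 0).W μ y ν y')
      = (1 / 2) * (tadpole (GcombSh n 0) (vertex2OfK (GcombSh n 0) n
              (fun κ u κ' u' => ((n : ℝ) ^ 8) • wilsonW₂ 3 ((8 * (N : ℝ) ^ 2)⁻¹ • wsym22 N) κ u κ' u' + cB • symVh₂SAn1 3 n κ u κ' u') μ y ν y')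
            + tadpole (GcombSh n 0) (vertex2OfK (GcombSh n 0) n
              (fun κ u κ' u' => ((n : ℝ) ^ 8) • wilsonW₂ 3 ((8 * (N : ℝ) ^ 2)⁻¹ • wsym22 N) κ u κ' u' + cB • symVh₂SAn1 3 n κ u κ' u') ν y' μ y))
        + (tadpole (GcombSh n 0) (mixOfK (GcombSh n 0) n (M2Of 3 n (w • symMixFFAt (ctr 4 n) n) 0) μ y ν y')
            + tadpole (GcombSh n 0) (mixOfK (GcombSh n 0) n (M2Of 3 n (w • symMixFFAt (ctr 4 n) n) 0) ν y' μ y)) := by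
  have sG : Spr (GcombSh (d := 3) n 0) := spr_GcombSh (d := 3) (Lc := n) 0
  -- the record's letters at level 0 (packaged)
  obtain ⟨Cs, δs, hδs, hS⟩ := locStencil_SpureCombOf (d := 3) (symTablesAn1S2w 3 n cΛ w) ((n : ℝ) ^ 4) (-((n : ℝ) ^ 8 / 2)) cΛ 0
  obtain ⟨CM, δM, hδM, hM⟩ := (symTablesAn1S2w 3 n cΛ w).hM 0
  obtain ⟨C₂, δ₂, hδ₂, hS₂⟩ := locStencil₂_literalS₂ n N (symTablesAn1S2w 3 n cΛ w) cB
  obtain ⟨CF, δF, hδF, hM₂⟩ := locStencilFM_literalM₂ n (symTablesAn1S2w 3 n cΛ w)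
  -- every word is localised
  have lP : ∀ (μ : Fin 4) (y : Fin 4 → ℤ) (ν : Fin 4) (y' : Fin 4 → ℤ), Loc (vertex2OfK (GcombSh n 0) n
      (fun κ u κ' u' => ((n : ℝ) ^ 8) • wilsonW₂ 3 ((8 * (N : ℝ) ^ 2)⁻¹ • wsym22 N) κ u κ' u'
        + cB • (symTablesAn1S2w 3 n cΛ w).vh₂S κ u κ' u') μ y ν y') :=
    fun μ y ν y' => loc_vertex2OfK_of_spr sG hS₂ hS₂.nonneg hδ₂ μ y ν y'
  have lX : ∀ (μ : Fin 4) (y : Fin 4 → ℤ) (ν : Fin 4) (y' : Fin 4 → ℤ),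
      Loc (mixOfK (GcombSh n 0) n (M2Of 3 n (symTablesAn1S2w 3 n cΛ w).mixFF 0) μ y ν y') :=
    fun μ y ν y' => loc_mixOfK_of_spr sG hM₂ hδF μ y ν y'
  have lR : ∀ (μ : Fin 4) (y : Fin 4 → ℤ) (ν : Fin 4) (y' : Fin 4 → ℤ),
      Loc (dM (K2OfK (GcombSh n 0) n (fun κ u => ((n : ℝ) ^ 4) • wilsonA 3 κ u + (-((n : ℝ) ^ 8 / 2)) • (symTablesAn1S2w 3 n cΛ w).V κ u)
        ((symTablesAn1S2w 3 n cΛ w).M 0) ν y') n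
        (fun κ u => ((n : ℝ) ^ 4) • wilsonA 3 κ u + (-((n : ℝ) ^ 8 / 2)) • (symTablesAn1S2w 3 n cΛ w).V κ u) ((symTablesAn1S2w 3 n cΛ w).M 0) μ y) := by
    intro μ y ν y'
    have lK2 : Loc (K2OfK (GcombSh n 0) n (fun κ u => ((n : ℝ) ^ 4) • wilsonA 3 κ u + (-((n : ℝ) ^ 8 / 2)) • (symTablesAn1S2w 3 n cΛ w).V κ u)
        ((symTablesAn1S2w 3 n cΛ w).M 0) ν y') :=
      ((sG.comp_loc (loc_dM_of_spr sG hS hδs hM hδM ν y')).comp_spr sG).neg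
    exact loc_dM_of_loc lK2 hS hδs hM hδM μ y
  -- the two chain words vanish
  have hR : ∀ (μ : Fin 4) (y : Fin 4 → ℤ) (ν : Fin 4) (y' : Fin 4 → ℤ),
      tadpole (GcombSh n 0) (dM (K2OfK (GcombSh n 0) n (fun κ u => ((n : ℝ) ^ 4) • wilsonA 3 κ u + (-((n : ℝ) ^ 8 / 2)) • (symTablesAn1S2w 3 n cΛ w).V κ u)
        ((symTablesAn1S2w 3 n cΛ w).M 0) ν y') n
        (fun κ u => ((n : ℝ) ^ 4) • wilsonA 3 κ u + (-((n : ℝ) ^ 8 / 2)) • (symTablesAn1S2w 3 n cΛ w).V κ u) ((symTablesAn1S2w 3 n cΛ w).M 0) μ y) = 0 :=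
    fun μ y ν y' => tadpole_chainWord_eq_zero n cΛ μ y ν y'
  -- open the carrier and split
  have hW : ∀ (μ : Fin 4) (y : Fin 4 → ℤ) (ν : Fin 4) (y' : Fin 4 → ℤ),
      tadpole (GcombSh n 0) (W2OfK (GcombSh n 0) n (fun κ u => ((n : ℝ) ^ 4) • wilsonA 3 κ u + (-((n : ℝ) ^ 8 / 2)) • (symTablesAn1S2w 3 n cΛ w).V κ u)
        ((symTablesAn1S2w 3 n cΛ w).M 0)
        (fun κ u κ' u' => ((n : ℝ) ^ 8) • wilsonW₂ 3 ((8 * (N : ℝ) ^ 2)⁻¹ • wsym22 N) κ u κ' u' + cB • (symTablesAn1S2w 3 n cΛ w).vh₂S κ u κ' u')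
        (M2Of 3 n (symTablesAn1S2w 3 n cΛ w).mixFF 0) μ y ν y')
      = tadpole (GcombSh n 0) (vertex2OfK (GcombSh n 0) n
              (fun κ u κ' u' => ((n : ℝ) ^ 8) • wilsonW₂ 3 ((8 * (N : ℝ) ^ 2)⁻¹ • wsym22 N) κ u κ' u' + cB • (symTablesAn1S2w 3 n cΛ w).vh₂S κ u κ' u') μ y ν y')
        + tadpole (GcombSh n 0) (mixOfK (GcombSh n 0) n (M2Of 3 n (symTablesAn1S2w 3 n cΛ w).mixFF 0) μ y ν y')
        + tadpole (GcombSh n 0) (mixOfK (GcombSh n 0) n (M2Of 3 n (symTablesAn1S2w 3 n cΛ w).mixFF 0) ν y' μ y) := by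
    intro μ y ν y'
    unfold W2OfK
    rw [tadpole_add sG (((lP μ y ν y').add (lX μ y ν y')).add (lX ν y' μ y)) (lR μ y ν y'),
      tadpole_add sG ((lP μ y ν y').add (lX μ y ν y')) (lX ν y' μ y), tadpole_add sG (lP μ y ν y') (lX μ y ν y'), hR μ y ν y', add_zero]
  have lW2 : ∀ (μ : Fin 4) (y : Fin 4 → ℤ) (ν : Fin 4) (y' : Fin 4 → ℤ),
      Loc (W2OfK (GcombSh n 0) n (fun κ u => ((n : ℝ) ^ 4) • wilsonA 3 κ u + (-((n : ℝ) ^ 8 / 2)) • (symTablesAn1S2w 3 n cΛ w).V κ u)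
        ((symTablesAn1S2w 3 n cΛ w).M 0)
        (fun κ u κ' u' => ((n : ℝ) ^ 8) • wilsonW₂ 3 ((8 * (N : ℝ) ^ 2)⁻¹ • wsym22 N) κ u κ' u' + cB • (symTablesAn1S2w 3 n cΛ w).vh₂S κ u κ' u')
        (M2Of 3 n (symTablesAn1S2w 3 n cΛ w).mixFF 0) μ y ν y') :=
    fun μ y ν y' => (((lP μ y ν y').add (lX μ y ν y')).add (lX ν y' μ y)).add (lR μ y ν y')
  rw [JsB12CombSh0_W_zero_eq]
  unfold W2SymOfK
  rw [tadpole_smul, tadpole_add sG (lW2 μ y ν y') (lW2 ν y' μ y), hW μ y ν y', hW ν y' μ y]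
  simp only [SymTablesAn1S2Weighted.symTablesAn1S2w_vh₂S, SymTablesAn1S2Weighted.symTablesAn1S2w_mixFF]
  ring

end Words

/-! ## §4 On the scales, at PART 22″-lit's pinned `W`: the carry's first term in words -/

section Scales

variable {Lc : ℕ} [NeZero Lc]

/-- [folklore] **THE CARRY's FIRST TERM AT THE (III″) LITERAL, IN WORDS** (PART 22″-lit `RoadEndBFxLitWS.d1Rep_BFx_lit_W_sbpS`, hypothesis `hJ2`, pin `hWpin`): at `n = Lc^m`
and every in-block root `r`, the pinned second-order family's tadpole at the road's kernel is the PAIR-WORD tadpole plus W2″a's TWO MIXED-WORD tadpoles at the literal's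
own leg `G′ = GcombSh (Lc^m) 0` — NO chain word (W2″b):
`tadpole (G₀^{bm} r) (W (Lc^m) μ y ν y′) = ½·(tadpole G′ (vertex2OfK G′ … T₂ μ y ν y′) + tadpole G′ (vertex2OfK G′ … T₂ ν y′ μ y)) + (tadpole G′ (mixOfK G′ … M₂ μ y ν y′) + tadpole G′ (mixOfK G′ … M₂ ν y′ μ y))`. -/
theorem carry_lit_words (hLc : Odd Lc) (hL : 1 < Lc) (Nlit : ℕ) (wlit cΛlit cBlit : ℕ → ℝ) (W : ℕ → Fin 4 → Site 4 → Fin 4 → Site 4 → MKer 4 (Fib 3))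
    (hWpin : W = (fun n : ℕ => if h : Odd n then (haveI : NeZero n := ⟨h.pos.ne'⟩;
        (JsB12CombShSym (Lc := n) h Nlit (symTablesAn1S2w 3 n (cΛlit (Nat.log Lc n)) (wlit (Nat.log Lc n))) (cΛlit (Nat.log Lc n)) (cBlit (Nat.log Lc n)) 0).W) else 0))
    (m : ℕ) {r : Fin 4 → ℕ} (hr : r ∈ box (3 + 1) (Lc ^ m)) (μ : Fin 4) (y : Fin 4 → ℤ) (ν : Fin 4) (y' : Fin 4 → ℤ) :
    tadpole (coDressKBmAt (toSite r) (Lc ^ m) (KInvStep (d := 3) (Lc ^ m) 0)) (W (Lc ^ m) μ y ν y')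
      = (1 / 2) * (tadpole (GcombSh (Lc ^ m) 0) (vertex2OfK (GcombSh (Lc ^ m) 0) (Lc ^ m)
              (fun κ u κ' u' => (((Lc ^ m : ℕ) : ℝ) ^ 8) • wilsonW₂ 3 ((8 * (Nlit : ℝ) ^ 2)⁻¹ • wsym22 Nlit) κ u κ' u'
                + cBlit m • symVh₂SAn1 3 (Lc ^ m) κ u κ' u') μ y ν y')
            + tadpole (GcombSh (Lc ^ m) 0) (vertex2OfK (GcombSh (Lc ^ m) 0) (Lc ^ m)
              (fun κ u κ' u' => (((Lc ^ m : ℕ) : ℝ) ^ 8) • wilsonW₂ 3 ((8 * (Nlit : ℝ) ^ 2)⁻¹ • wsym22 Nlit) κ u κ' u'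
                + cBlit m • symVh₂SAn1 3 (Lc ^ m) κ u κ' u') ν y' μ y))
        + (tadpole (GcombSh (Lc ^ m) 0) (mixOfK (GcombSh (Lc ^ m) 0) (Lc ^ m) (M2Of 3 (Lc ^ m) (wlit m • symMixFFAt (ctr 4 (Lc ^ m)) (Lc ^ m)) 0) μ y ν y')
            + tadpole (GcombSh (Lc ^ m) 0) (mixOfK (GcombSh (Lc ^ m) 0) (Lc ^ m) (M2Of 3 (Lc ^ m) (wlit m • symMixFFAt (ctr 4 (Lc ^ m)) (Lc ^ m)) 0) ν y' μ y)) := by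
  rw [hWpin, RoadLitPinAn1W.W_at_pow Lc Nlit wlit cΛlit cBlit hLc hL m, JcOfTabs_apply,
    tadpole_G₀bm_dressedW (Lc ^ m) hLc.pow Nlit (symTablesAn1S2w 3 (Lc ^ m) (cΛlit m) (wlit m)) (cΛlit m) (cBlit m) hr μ y ν y']
  exact tadpole_GcombSh_rawW_words (Lc ^ m) hLc.pow Nlit (cΛlit m) (wlit m) (cBlit m) μ y ν y'

end Scales

end Summit.QuantumFields.BalabanUV.Beta.D1BFx.RoadLitWSlotTadpole

end
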